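import Literature.Analysis.FluidPDE.JetStressAlgebra
import Literature.Analysis.FluidPDE.NSRTimeGluing
import HarnessLib

/-!
# The intermittent-jet perturbation with a time weight: the stress algebra (BV §7.6 with the
  energy cut-off of Ann. of Math. 189 (2019), §7)

Analysis/FluidPDE support file (all results proved; definitions are explicit constructions) for
the TIME-WEIGHTED intermittent-jet perturbation used by the energy iteration of Buckmaster–Vicol
(Ann. of Math. 189 (2019), Prop. 2.1: the energy profile is prescribed, so the perturbation has
to be switched on and off in time and its energy has to be tuned; EMS Surv. Math. Sci. 6 (2019),
§7.6 for the algebra). For the datum `D` of `JetPerturbation` (stress to be cancelled `D.M =: N`)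
and a scalar weight `s = s(t)`, smooth on `[0, T]`:

* `D.wW' s = s w^{(p+c)} + s² X`, `D.zetaW s = s² ζ`, `D.wW s = wW' + ∇zetaW = s (w^{(p)}+w^{(c)}) + s² w^{(t)}`:
  the principal part is weighted by `s`, the temporal corrector by `s²` (it is quadratic in the
  amplitudes);
* **the identity `(⋆_s)`** (`Datum.starW`): with the base stress `R_c + s² N̊` (note the weight `s²`
  on the cancelled stress),
  `∂ₜw̃ + div(w̃ ⊗ w̃) + div(R_c + s² N̊) = div S̃₁ + ∇q̃ + f̃` with
  `S̃₁ = R_c + (s w^{(p)}) ⊗ w̃_r + w̃_r ⊗ (s w^{(p)}) + w̃_r ⊗ w̃_r + s² S_osc` (`w̃_r = w̃ - s w^{(p)}`),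
  `q̃ = ∂ₜ(s²ζ) + s²(ρ - tr N/3 - ∑ π_osc)`, `f̃ = s f₁ + s² (f₂ + f₃ + f₄) + s' w^{(p+c)} + 2 s s' X`
  (the tree's `(⋆)` of `JetStressAlgebra` is the case `s ≡ 1`; the two last terms of `f̃` are the
  price of the time cut-off, BV 2019 §7 "the time cutoffs");
* the new Navier–Stokes–Reynolds triple (`Datum.isNSReynoldsOn_newW`, by `Torus.IsNSReynoldsOn.perturb_visc`),
  and its LOCALITY: at a time where `s = s' = 0` the new velocity is the old one and the new stress is
  `R̊_c` (`Datum.newW_of_weight_eq_zero`).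

## References

* T. Buckmaster, V. Vicol, Ann. of Math. 189 (2019) = arXiv:1709.10033, Prop. 2.1, §7. [`BuckmasterVicol2019Annals`]
* T. Buckmaster, V. Vicol, EMS Surv. Math. Sci. 6 (2019) = arXiv:1901.09023, §7.5.3 (7.37)–(7.39),
  §7.6 (7.47)–(7.59). [`BuckmasterVicol2020`]
-/

noncomputable section

open MeasureTheory Set Filter Topology Function
open scoped InnerProductSpace ContDiff ENNReal

namespace Literature.Analysis.FluidPDE

namespace JetStep

open Literature.Analysis.FunctionSpaces FunctionSpaces.Torus Mikado NashGeometric Jet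

local notation "𝕋³" => UnitAddTorus (Fin 3)
local notation "E³" => EuclideanSpace ℝ (Fin 3)
local notation "Idx" => Index (Fin 3)

namespace Datum

/-! ## The weighted perturbation -/

section Defs

variable (D : Datum) (s : ℝ → ℝ)

/-- The one-sided time derivative of the weight within `[0, T]`. [folklore] -/
def sdot (t : ℝ) : ℝ := derivWithin s (Icc 0 D.T) t

/-- **The non-gradient part of the weighted perturbation** `w̃' = s w^{(p+c)} + s² X`.
[cite: BuckmasterVicol2019Annals, §7] -/
def wW' (t : ℝ) (y : 𝕋³) : E³ := s t • D.wpc t y + (s t) ^ 2 • D.X t y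

/-- **The gradient potential of the weighted perturbation** `ζ̃ = s² ζ`. [cite: BuckmasterVicol2019Annals, §7] -/
def zetaW (t : ℝ) (y : 𝕋³) : ℝ := (s t) ^ 2 * D.zeta t y

/-- **The weighted perturbation** `w̃ = w̃' + ∇ζ̃ = s (w^{(p)} + w^{(c)}) + s² w^{(t)}`. [cite: BuckmasterVicol2019Annals, §7] -/
def wW (t : ℝ) (y : 𝕋³) : E³ := D.wW' s t y + Torus.gradient (D.zetaW s t) y

/-- `w̃ - s w^{(p)}` (the weighted correctors). [folklore] -/
def wrW (t : ℝ) (y : 𝕋³) : E³ := D.wW s t y - s t • D.wp t y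

/-- The weighted cross tensor `(s wp) ⊗ w̃r + w̃r ⊗ (s wp) + w̃r ⊗ w̃r`. [cite: BuckmasterVicol2020, §7.6.3 (7.54)] -/
def crossW (t : ℝ) : 𝕋³ → Fin 3 → E³ := fun y j =>
  Torus.tensorProd (fun z => s t • D.wp t z) (D.wrW s t) y j + Torus.tensorProd (D.wrW s t) (fun z => s t • D.wp t z) y j +
    Torus.tensorProd (D.wrW s t) (D.wrW s t) y j

/-- **The tensor `S̃₁` of `(⋆_s)`**: carried stress + weighted cross terms + `s²` times the oscillation
tensors. [folklore] -/
def S₁W (Rc : ℝ → 𝕋³ → Fin 3 → E³) (t : ℝ) : 𝕋³ → Fin 3 → E³ := fun y j =>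
  Rc t y j + D.crossW s t y j + (s t) ^ 2 • D.Sosc t y j

/-- The time derivative of `ζ̃`. [folklore] -/
def zetaWdot (t : ℝ) : 𝕋³ → ℝ := Torus.timeDerivWithin (Icc 0 D.T) (D.zetaW s) t

/-- **The scalar `q̃` of `(⋆_s)`**: `∂ₜζ̃ + s²(ρ - tr N/3 - ∑_x π_osc,x)`. [folklore] -/
def qfunW (t : ℝ) (y : 𝕋³) : ℝ :=
  D.zetaWdot s t y + (s t) ^ 2 * (JAmp.rho D.γ₀ D.M t y - Torus.tensorTrace (D.M t) y / 3 -
    ∑ x, Torus.expansionPressure (D.cvec x t) (D.Psi x t) y)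

/-- **The source `f̃` of `(⋆_s)`**: `s f₁ + s² (f₂ + f₃ + f₄) + s' wpc + 2 s s' X`. [folklore] -/
def ffunW (t : ℝ) (y : 𝕋³) : E³ :=
  s t • D.f₁ t y + (s t) ^ 2 • (D.f₂ t y + D.f₃ t y + D.f₄ t) + D.sdot s t • D.wpc t y + (2 * s t * D.sdot s t) • D.X t y

end Defs

variable {D : Datum} (h : D.Valid) {s : ℝ → ℝ} (hs : ContDiffOn ℝ ∞ s (Icc 0 D.T))
include h

/-! ## Smoothness -/

section Smooth

include hs

omit h in
/-- The weight as a (spatially constant) jointly smooth field. [folklore] -/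
theorem smooth_weight : Torus.IsSmoothSpaceTimeOn (Icc 0 D.T) (fun t (_ : 𝕋³) => s t) :=
  FluidPDE.Torus.isSmoothSpaceTimeOn_time hs

omit h in
/-- The squared weight as a jointly smooth field. [folklore] -/
theorem smooth_weight_sq : Torus.IsSmoothSpaceTimeOn (Icc 0 D.T) (fun t (_ : 𝕋³) => (s t) ^ 2) := by
  have e : (fun t (_ : 𝕋³) => (s t) ^ 2) = fun t (y : 𝕋³) => (fun t (_ : 𝕋³) => s t) t y * (fun t (_ : 𝕋³) => s t) t y := by
    funext t y; ring
  rw [e]; exact (smooth_weight hs).mul (smooth_weight hs)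

/-- The derivative of the weight as a jointly smooth field. [folklore] -/
theorem smooth_sdot : Torus.IsSmoothSpaceTimeOn (Icc 0 D.T) (fun t (_ : 𝕋³) => D.sdot s t) :=
  FluidPDE.Torus.isSmoothSpaceTimeOn_time (FluidPDE.Torus.contDiffOn_derivWithin_Icc h.hT hs)

/-- Smoothness / admissibility bookkeeping. [folklore] -/
theorem smooth_wW' : Torus.IsSmoothSpaceTimeOn (Icc 0 D.T) (D.wW' s) :=
  ((smooth_weight hs).smul (smooth_wpc h)).add ((smooth_weight_sq hs).smul (smooth_X h))

/-- Smoothness / admissibility bookkeeping. [folklore] -/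
theorem smooth_zetaW : Torus.IsSmoothSpaceTimeOn (Icc 0 D.T) (D.zetaW s) := (smooth_weight_sq hs).mul (smooth_zeta h)

/-- Smoothness / admissibility bookkeeping. [folklore] -/
theorem smooth_wW : Torus.IsSmoothSpaceTimeOn (Icc 0 D.T) (D.wW s) :=
  (smooth_wW' h hs).add ((smooth_zetaW h hs).gradient (uniqueDiffOn h))

/-- Smoothness / admissibility bookkeeping. [folklore] -/
theorem smooth_swp : Torus.IsSmoothSpaceTimeOn (Icc 0 D.T) (fun t z => s t • D.wp t z) := (smooth_weight hs).smul (smooth_wp h)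

/-- Smoothness / admissibility bookkeeping. [folklore] -/
theorem smooth_wrW : Torus.IsSmoothSpaceTimeOn (Icc 0 D.T) (D.wrW s) := (smooth_wW h hs).sub (smooth_swp h hs)

/-- Smoothness / admissibility bookkeeping. [folklore] -/
theorem isSmooth_wrW {t : ℝ} (ht : t ∈ Icc 0 D.T) : Torus.IsSmooth (D.wrW s t) := (smooth_wrW h hs).isSmooth_slice ht

/-- Smoothness / admissibility bookkeeping. [folklore] -/
theorem isSmooth_swp {t : ℝ} (ht : t ∈ Icc 0 D.T) : Torus.IsSmooth (fun z => s t • D.wp t z) := (smooth_swp h hs).isSmooth_slice ht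

/-- Smoothness / admissibility bookkeeping. [folklore] -/
theorem smooth_crossW : Torus.IsSmoothSpaceTimeOn (Icc 0 D.T) (D.crossW s) :=
  (((smooth_swp h hs).tensorProd (smooth_wrW h hs)).add ((smooth_wrW h hs).tensorProd (smooth_swp h hs))).add
    ((smooth_wrW h hs).tensorProd (smooth_wrW h hs))

/-- Smoothness / admissibility bookkeeping. [folklore] -/
theorem isSmooth_crossW {t : ℝ} (ht : t ∈ Icc 0 D.T) : Torus.IsSmooth (D.crossW s t) := (smooth_crossW h hs).isSmooth_slice ht

/-- Smoothness / admissibility bookkeeping. [folklore] -/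
theorem smooth_sqSosc : Torus.IsSmoothSpaceTimeOn (Icc 0 D.T) (fun t z j => (s t) ^ 2 • D.Sosc t z j) :=
  Torus.isSmoothSpaceTimeOn_pi.2 fun j => (smooth_weight_sq hs).smul (Torus.isSmoothSpaceTimeOn_pi.1 (smooth_Sosc h) j)

/-- Smoothness / admissibility bookkeeping. [folklore] -/
theorem smooth_S₁W {Rc : ℝ → 𝕋³ → Fin 3 → E³} (hRc : Torus.IsSmoothSpaceTimeOn (Icc 0 D.T) Rc) :
    Torus.IsSmoothSpaceTimeOn (Icc 0 D.T) (D.S₁W s Rc) :=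
  (hRc.add (smooth_crossW h hs)).add (smooth_sqSosc h hs)

/-- Smoothness / admissibility bookkeeping. [folklore] -/
theorem smooth_zetaWdot : Torus.IsSmoothSpaceTimeOn (Icc 0 D.T) (D.zetaWdot s) := (smooth_zetaW h hs).timeDerivWithin (uniqueDiffOn h)

omit hs in
/-- Smoothness / admissibility bookkeeping. [folklore] -/
theorem smooth_qcore : Torus.IsSmoothSpaceTimeOn (Icc 0 D.T) (fun t y => JAmp.rho D.γ₀ D.M t y - Torus.tensorTrace (D.M t) y / 3 -
    ∑ x, Torus.expansionPressure (D.cvec x t) (D.Psi x t) y) := by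
  have hρ := JAmp.isSmoothSpaceTimeOn_rho h.hγ h.hM
  have htr : Torus.IsSmoothSpaceTimeOn (Icc 0 D.T) (fun t y => Torus.tensorTrace (D.M t) y / 3) := h.hM.tensorTrace.div_const _
  have hπ : Torus.IsSmoothSpaceTimeOn (Icc 0 D.T) (fun t y => ∑ x, Torus.expansionPressure (D.cvec x t) (D.Psi x t) y) :=
    Torus.IsSmoothSpaceTimeOn.sum fun x _ => smooth_expansionPressure' (uniqueDiffOn h) (smooth_cvec h x) (smooth_Psi h x)
  exact (hρ.sub htr).sub hπ

/-- Smoothness / admissibility bookkeeping. [folklore] -/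
theorem smooth_qfunW : Torus.IsSmoothSpaceTimeOn (Icc 0 D.T) (D.qfunW s) :=
  (smooth_zetaWdot h hs).add ((smooth_weight_sq hs).mul (smooth_qcore h))

omit hs in
/-- Smoothness / admissibility bookkeeping. [folklore] -/
theorem smooth_f234 : Torus.IsSmoothSpaceTimeOn (Icc 0 D.T) (fun t y => D.f₂ t y + D.f₃ t y + D.f₄ t) :=
  ((smooth_f₂ h).add (smooth_f₃ h)).add (smooth_f₄ h)

/-- Smoothness / admissibility bookkeeping. [folklore] -/
theorem smooth_ffunW : Torus.IsSmoothSpaceTimeOn (Icc 0 D.T) (D.ffunW s) := by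
  have h1 : Torus.IsSmoothSpaceTimeOn (Icc 0 D.T) (fun t y => s t • D.f₁ t y) := (smooth_weight hs).smul (smooth_f₁ h)
  have h2 : Torus.IsSmoothSpaceTimeOn (Icc 0 D.T) (fun t y => (s t) ^ 2 • (D.f₂ t y + D.f₃ t y + D.f₄ t)) :=
    (smooth_weight_sq hs).smul (smooth_f234 h)
  have h3 : Torus.IsSmoothSpaceTimeOn (Icc 0 D.T) (fun t y => D.sdot s t • D.wpc t y) := (smooth_sdot h hs).smul (smooth_wpc h)
  have h4' : Torus.IsSmoothSpaceTimeOn (Icc 0 D.T) (fun t (_ : 𝕋³) => 2 * s t * D.sdot s t) :=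
    ((Torus.isSmoothSpaceTimeOn_const (Torus.isSmooth_const (2 : ℝ)) _).mul (smooth_weight hs)).mul (smooth_sdot h hs)
  have h4 : Torus.IsSmoothSpaceTimeOn (Icc 0 D.T) (fun t y => (2 * s t * D.sdot s t) • D.X t y) := h4'.smul (smooth_X h)
  exact ((h1.add h2).add h3).add h4

end Smooth

/-! ## Divergence and mean of the weighted perturbation -/

omit h in
/-- `w̃ = Torus.incr w̃' ζ̃`. [folklore] -/
theorem wW_eq_incr : D.wW s = Torus.incr (D.wW' s) (D.zetaW s) := rfl

/-- `∫ X = 0`. [folklore] -/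
theorem integral_X {t : ℝ} (ht : t ∈ Icc 0 D.T) : ∫ y, D.X t y = 0 := by
  have hw := hasZeroMean_w h ht
  have hζ : Torus.IsSmooth (D.zeta t) := (smooth_zeta h).isSmooth_slice ht
  have hwpc : Torus.IsSmooth (D.wpc t) := (smooth_wpc h).isSmooth_slice ht
  have hX : Torus.IsSmooth (D.X t) := (smooth_X h).isSmooth_slice ht
  have i1 : Integrable (fun y => D.wpc t y + D.X t y) volume := (hwpc.add hX).integrable
  have e : ∫ y, D.w t y = (∫ y, D.wpc t y) + (∫ y, D.X t y) + ∫ y, Torus.gradient (D.zeta t) y := by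
    rw [show D.w t = fun y => (D.wpc t y + D.X t y) + Torus.gradient (D.zeta t) y from rfl,
      integral_add i1 hζ.gradient.integrable, integral_add hwpc.integrable hX.integrable]
  rw [Torus.HasZeroMean] at hw
  rw [hw, integral_wpc h ht, Torus.integral_gradient_eq_zero hζ, zero_add, add_zero] at e
  exact e.symm

include hs in
/-- **`div w̃ = 0`**. [cite: BuckmasterVicol2020, §7.5 (7.38)] -/
theorem isDivFree_wW {t : ℝ} (ht : t ∈ Icc 0 D.T) : Torus.IsDivFree (D.wW s t) := by
  intro y
  have hζ : Torus.IsSmooth (D.zeta t) := (smooth_zeta h).isSmooth_slice ht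
  have hζW : Torus.IsSmooth (D.zetaW s t) := (smooth_zetaW h hs).isSmooth_slice ht
  have hwpc : Torus.IsSmooth (D.wpc t) := (smooth_wpc h).isSmooth_slice ht
  have hX : Torus.IsSmooth (D.X t) := (smooth_X h).isSmooth_slice ht
  have hw' : Torus.IsSmooth (D.wW' s t) := (smooth_wW' h hs).isSmooth_slice ht
  have h1 : Torus.IsSmooth (fun z => s t • D.wpc t z) := hwpc.smul (s t)
  have h2 : Torus.IsSmooth (fun z => (s t) ^ 2 • D.X t z) := hX.smul ((s t) ^ 2)
  show Torus.divergence (fun y => D.wW' s t y + Torus.gradient (D.zetaW s t) y) y = 0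
  rw [Torus.divergence_add' hw' hζW.gradient, Torus.divergence_gradient' hζW,
    show D.zetaW s t = (s t) ^ 2 • D.zeta t from rfl, laplacian_const_smul_apply hζ, laplacian_zeta h ht,
    show D.wW' s t = fun y => s t • D.wpc t y + (s t) ^ 2 • D.X t y from rfl, Torus.divergence_add' h1 h2,
    show (fun z => s t • D.wpc t z) = s t • D.wpc t from rfl, Torus.divergence_const_smul (hwpc.isContDiff (by simp)),
    show (fun z => (s t) ^ 2 • D.X t z) = (s t) ^ 2 • D.X t from rfl, Torus.divergence_const_smul (hX.isContDiff (by simp)),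
    divergence_wpc h ht, divergence_X h ht]
  simp

include hs in
/-- **`∫ w̃ = 0`**. [folklore] -/
theorem hasZeroMean_wW {t : ℝ} (ht : t ∈ Icc 0 D.T) : Torus.HasZeroMean (D.wW s t) := by
  have hζW : Torus.IsSmooth (D.zetaW s t) := (smooth_zetaW h hs).isSmooth_slice ht
  have hwpc : Torus.IsSmooth (D.wpc t) := (smooth_wpc h).isSmooth_slice ht
  have hX : Torus.IsSmooth (D.X t) := (smooth_X h).isSmooth_slice ht
  have h1 : Torus.IsSmooth (fun z => s t • D.wpc t z) := hwpc.smul (s t)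
  have h2 : Torus.IsSmooth (fun z => (s t) ^ 2 • D.X t z) := hX.smul ((s t) ^ 2)
  show ∫ y, (D.wW' s t y + Torus.gradient (D.zetaW s t) y) = 0
  rw [integral_add ((smooth_wW' h hs).isSmooth_slice ht).integrable hζW.gradient.integrable, Torus.integral_gradient_eq_zero hζW,
    add_zero, show D.wW' s t = fun y => s t • D.wpc t y + (s t) ^ 2 • D.X t y from rfl, integral_add h1.integrable h2.integrable,
    integral_smul, integral_smul, integral_wpc h ht, integral_X h ht, smul_zero, smul_zero, add_zero]

/-! ## The identity `(⋆_s)` -/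

include hs in
/-- **`∂ₜw̃ = s' wpc + s ∂ₜwpc + 2 s s' X + s² ∂ₜX + ∇∂ₜζ̃`**. [folklore] -/
theorem timeDerivWithin_wW {t : ℝ} (ht : t ∈ Icc 0 D.T) (y : 𝕋³) :
    Torus.timeDerivWithin (Icc 0 D.T) (D.wW s) t y =
      (D.sdot s t • D.wpc t y + s t • Torus.timeDerivWithin (Icc 0 D.T) D.wpc t y) +
      ((2 * s t * D.sdot s t) • D.X t y + (s t) ^ 2 • Torus.timeDerivWithin (Icc 0 D.T) D.X t y) +
      Torus.gradient (D.zetaWdot s t) y := by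
  have hU := uniqueDiffOn h
  have hsd : HasDerivWithinAt s (D.sdot s t) (Icc 0 D.T) t := ((hs.differentiableOn (by simp)) t ht).hasDerivWithinAt
  have hsd2 : HasDerivWithinAt (fun τ => (s τ) ^ 2) (2 * s t * D.sdot s t) (Icc 0 D.T) t := by
    have e : (fun τ => (s τ) ^ 2) = s * s := by funext τ; simp [sq]
    rw [e]
    refine (hsd.mul hsd).congr_deriv ?_
    ring
  have h1 : HasDerivWithinAt (fun τ => s τ • D.wpc τ y) (s t • Torus.timeDerivWithin (Icc 0 D.T) D.wpc t y + D.sdot s t • D.wpc t y)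
      (Icc 0 D.T) t := hsd.smul ((smooth_wpc h).hasDerivWithinAt_slice ht y)
  have h2 : HasDerivWithinAt (fun τ => (s τ) ^ 2 • D.X τ y)
      ((s t) ^ 2 • Torus.timeDerivWithin (Icc 0 D.T) D.X t y + (2 * s t * D.sdot s t) • D.X t y) (Icc 0 D.T) t :=
    hsd2.smul ((smooth_X h).hasDerivWithinAt_slice ht y)
  have e1 : Torus.timeDerivWithin (Icc 0 D.T) (D.wW' s) t y =
      (s t • Torus.timeDerivWithin (Icc 0 D.T) D.wpc t y + D.sdot s t • D.wpc t y) +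
      ((s t) ^ 2 • Torus.timeDerivWithin (Icc 0 D.T) D.X t y + (2 * s t * D.sdot s t) • D.X t y) :=
    (h1.add h2).derivWithin (hU t ht)
  rw [show D.wW s = fun τ z => D.wW' s τ z + Torus.gradient (D.zetaW s τ) z from rfl,
    Torus.timeDerivWithin_add (smooth_wW' h hs) ((smooth_zetaW h hs).gradient hU) hU ht,
    timeDerivWithin_gradient_comm h.hT (smooth_zetaW h hs) ht, e1]
  show _ = _
  simp only [zetaWdot]
  abel

omit h in
/-- **Disjoint supports**: `w̃ ⊗ w̃ = s² wp ⊗ wp + crossW`. [folklore] -/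
theorem tensorProd_wW (t : ℝ) :
    Torus.tensorProd (D.wW s t) (D.wW s t) = fun z j => (s t) ^ 2 • Torus.tensorProd (D.wp t) (D.wp t) z j + D.crossW s t z j := by
  funext z j
  have ew : D.wW s t z = s t • D.wp t z + D.wrW s t z := by simp [wrW]
  simp only [Torus.tensorProd, crossW, ew, PiLp.add_apply, PiLp.smul_apply, smul_eq_mul, add_smul, smul_add, smul_smul]
  module

include hs in
/-- **The identity `(⋆_s)`**: for any jointly smooth carried stress `R_c`,
`∂ₜw̃ + div(w̃ ⊗ w̃) + div(R_c + s² N̊) = div S̃₁ + ∇q̃ + f̃` on `[0, T] × 𝕋³`.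
[cite: BuckmasterVicol2019Annals, §7; BuckmasterVicol2020, §7.6 (7.47)] -/
theorem starW {Rc : ℝ → 𝕋³ → Fin 3 → E³} (hRc : Torus.IsSmoothSpaceTimeOn (Icc 0 D.T) Rc) {t : ℝ} (ht : t ∈ Icc 0 D.T) (y : 𝕋³) :
    Torus.timeDerivWithin (Icc 0 D.T) (D.wW s) t y + Torus.tensorDivergence (Torus.tensorProd (D.wW s t) (D.wW s t)) y +
      Torus.tensorDivergence (fun z j => Rc t z j + (s t) ^ 2 • Torus.traceless (D.M t) z j) y =
    Torus.tensorDivergence (D.S₁W s Rc t) y + Torus.gradient (D.qfunW s t) y + D.ffunW s t y := by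
  -- smoothness at time `t`
  have hwp := isSmooth_wp h ht
  have hM : Torus.IsSmooth (D.M t) := h.hM.isSmooth_slice ht
  have hRct : Torus.IsSmooth (Rc t) := hRc.isSmooth_slice ht
  have hρ : Torus.IsSmooth (JAmp.rho D.γ₀ D.M t) := (JAmp.isSmoothSpaceTimeOn_rho h.hγ h.hM).isSmooth_slice ht
  have hh : ∀ x, Torus.IsSmooth (JAmp.hsq D.γ₀ D.M x t) := fun x => (smooth_hsq h x).isSmooth_slice ht
  have hfF : ∀ x, Torus.IsSmooth (Jet.fastF (D.J x) D.s x t) := fun x => (smooth_fastF h x).isSmooth_slice ht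
  have hζd : Torus.IsSmooth (D.zetaWdot s t) := (smooth_zetaWdot h hs).isSmooth_slice ht
  have hπ : ∀ x, Torus.IsSmooth (Torus.expansionPressure (D.cvec x t) (D.Psi x t)) := fun x =>
    Torus.isSmooth_expansionPressure (isSmooth_cvec h x ht) (isSmooth_Psi h x ht)
  have htr : Torus.IsSmooth (fun z => Torus.tensorTrace (D.M t) z / 3) := hM.tensorTrace.div_const _
  have hcore : Torus.IsSmooth (fun z => JAmp.rho D.γ₀ D.M t z - Torus.tensorTrace (D.M t) z / 3 -
      ∑ x, Torus.expansionPressure (D.cvec x t) (D.Psi x t) z) := (smooth_qcore h).isSmooth_slice ht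
  have hsM : Torus.IsSmooth (fun z j => (s t) ^ 2 • Torus.traceless (D.M t) z j) := hM.traceless.smul ((s t) ^ 2)
  have hcr := isSmooth_crossW h hs ht
  have hSo := isSmooth_Sosc h ht
  have hsSo : Torus.IsSmooth (fun z j => (s t) ^ 2 • D.Sosc t z j) := hSo.smul ((s t) ^ 2)
  -- (1) the time derivative
  have e1 := timeDerivWithin_wW h hs ht y
  have e1X := timeDerivWithin_X h ht y
  -- (2) the transport
  have e2 : Torus.tensorDivergence (Torus.tensorProd (D.wW s t) (D.wW s t)) y =
      (s t) ^ 2 • ∑ x, dirD x (D.F x t) y • dirVec x + Torus.tensorDivergence (D.crossW s t) y := by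
    have c1 : Torus.IsContDiff 1 (fun z j => (s t) ^ 2 • Torus.tensorProd (D.wp t) (D.wp t) z j) :=
      ((hwp.tensorProd hwp).smul ((s t) ^ 2)).isContDiff (by simp)
    rw [tensorProd_wW (D := D) (s := s) t, Torus.tensorDivergence_add_apply c1 (hcr.isContDiff (by simp)),
      Torus.tensorDivergence_const_smul_apply ((hwp.tensorProd hwp).isContDiff (by simp)), tensorDivergence_tensorProd_wp h ht]
  have eF : ∀ x, dirD x (D.F x t) y = JAmp.hsq D.γ₀ D.M x t y * dirD x (Jet.fastF (D.J x) D.s x t) y +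
      Jet.fastF (D.J x) D.s x t y * dirD x (JAmp.hsq D.γ₀ D.M x t) y := by
    intro x
    have e : D.F x t = fun z => JAmp.hsq D.γ₀ D.M x t z * Jet.fastF (D.J x) D.s x t z := by funext z; rw [F, a_sq h]
    rw [e, dirD_mul x ((hh x).isContDiff (by simp)) ((hfF x).isContDiff (by simp))]
  -- (3) the old stress
  have e3 : Torus.tensorDivergence (fun z j => Rc t z j + (s t) ^ 2 • Torus.traceless (D.M t) z j) y =
      Torus.tensorDivergence (Rc t) y + (s t) ^ 2 • ((Torus.gradient (JAmp.rho D.γ₀ D.M t) y -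
        ∑ x, dirD x (JAmp.hsq D.γ₀ D.M x t) y • dirVec x) - Torus.gradient (fun z => Torus.tensorTrace (D.M t) z / 3) y) := by
    rw [Torus.tensorDivergence_add_apply (hRct.isContDiff (by simp)) (hsM.isContDiff (by simp)),
      Torus.tensorDivergence_const_smul_apply (hM.traceless.isContDiff (by simp)), Torus.tensorDivergence_traceless hM,
      tensorDivergence_M h ht]
    simp only [Fintype.card_fin, Nat.cast_ofNat]
  -- (4) the oscillation expansion, summed
  have e4 : ∑ x, (dirD x (JAmp.hsq D.γ₀ D.M x t) y * (Jet.fastF (D.J x) D.s x t y - 1)) • dirVec x =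
      Torus.tensorDivergence (D.Sosc t) y - Torus.gradient (fun z => ∑ x, Torus.expansionPressure (D.cvec x t) (D.Psi x t) z) y +
        D.f₂ t y := by
    simp_rw [oscillation_expansion h _ ht y]
    rw [Finset.sum_sub_distrib, Finset.sum_sub_distrib, f₂,
      show D.Sosc t = fun z j => ∑ x ∈ Finset.univ, Torus.expansionTensor (D.cvec x t) (D.Psi x t) z j from rfl,
      CL22.Datum.tensorDivergence_finset_sum_apply _ (fun x _ => isSmooth_Sosc_term h x ht),
      show (fun z => ∑ x, Torus.expansionPressure (D.cvec x t) (D.Psi x t) z) =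
        fun z => ∑ x ∈ Finset.univ, Torus.expansionPressure (D.cvec x t) (D.Psi x t) z from rfl,
      CL22.Datum.gradient_finset_sum_apply _ (fun x _ => hπ x)]
    abel
  -- (5) the right-hand side
  have e5 : Torus.tensorDivergence (D.S₁W s Rc t) y = Torus.tensorDivergence (Rc t) y + Torus.tensorDivergence (D.crossW s t) y +
      (s t) ^ 2 • Torus.tensorDivergence (D.Sosc t) y := by
    have hA : Torus.IsSmooth (fun z j => Rc t z j + D.crossW s t z j) := hRct.add hcr
    rw [show D.S₁W s Rc t = fun z j => (Rc t z j + D.crossW s t z j) + (s t) ^ 2 • D.Sosc t z j from rfl,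
      Torus.tensorDivergence_add_apply (hA.isContDiff (by simp)) (hsSo.isContDiff (by simp)),
      Torus.tensorDivergence_add_apply (hRct.isContDiff (by simp)) (hcr.isContDiff (by simp)),
      Torus.tensorDivergence_const_smul_apply (hSo.isContDiff (by simp))]
  have e6 : Torus.gradient (D.qfunW s t) y = Torus.gradient (D.zetaWdot s t) y + (s t) ^ 2 • (Torus.gradient (JAmp.rho D.γ₀ D.M t) y -
      Torus.gradient (fun z => Torus.tensorTrace (D.M t) z / 3) y -
      Torus.gradient (fun z => ∑ x, Torus.expansionPressure (D.cvec x t) (D.Psi x t) z) y) := by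
    have hsumpi : Torus.IsSmooth (fun z => ∑ x, Torus.expansionPressure (D.cvec x t) (D.Psi x t) z) :=
      Torus.isSmooth_finset_sum _ fun x _ => hπ x
    have hA : Torus.IsSmooth (fun z => JAmp.rho D.γ₀ D.M t z - Torus.tensorTrace (D.M t) z / 3) := hρ.sub htr
    have hc2 : Torus.IsSmooth (fun z => (s t) ^ 2 * (JAmp.rho D.γ₀ D.M t z - Torus.tensorTrace (D.M t) z / 3 -
        ∑ x, Torus.expansionPressure (D.cvec x t) (D.Psi x t) z)) := (Torus.isSmooth_const _).mul hcore
    rw [show D.qfunW s t = fun z => D.zetaWdot s t z + (s t) ^ 2 * (JAmp.rho D.γ₀ D.M t z - Torus.tensorTrace (D.M t) z / 3 -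
        ∑ x, Torus.expansionPressure (D.cvec x t) (D.Psi x t) z) from rfl,
      Torus.gradient_add_apply (hζd.isContDiff (by simp)) (hc2.isContDiff (by simp)),
      Torus.gradient_const_mul_apply (hcore.isContDiff (by simp)),
      CL22.Datum.gradient_sub_apply hA hsumpi, CL22.Datum.gradient_sub_apply hρ htr]
  -- the sums over `x`
  have hsums : ∑ x, dirD x (D.F x t) y • dirVec x - ∑ x, (D.mup⁻¹ * (D.Fdot x t y - ∫ z, D.Fdot x t z)) • dirVec x -
      ∑ x, dirD x (JAmp.hsq D.γ₀ D.M x t) y • dirVec x =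
      ∑ x, (dirD x (JAmp.hsq D.γ₀ D.M x t) y * (Jet.fastF (D.J x) D.s x t y - 1)) • dirVec x -
      ∑ x, (D.mup⁻¹ * (D.hdot x t y * Jet.fastF (D.J x) D.s x t y)) • dirVec x +
      ∑ x, (D.mup⁻¹ * ∫ z, D.Fdot x t z) • dirVec x := by
    rw [← Finset.sum_sub_distrib, ← Finset.sum_sub_distrib, ← Finset.sum_sub_distrib, ← Finset.sum_add_distrib]
    refine Finset.sum_congr rfl fun x _ => ?_
    have hm : D.mup ≠ 0 := h.hmup.ne'
    rw [eF x, Fdot_eq h x ht y, ← sub_smul, ← sub_smul, ← sub_smul, ← add_smul]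
    congr 1
    field_simp
    ring
  have key : ∑ x, dirD x (D.F x t) y • dirVec x - ∑ x, (D.mup⁻¹ * (D.Fdot x t y - ∫ z, D.Fdot x t z)) • dirVec x -
      ∑ x, dirD x (JAmp.hsq D.γ₀ D.M x t) y • dirVec x -
      (Torus.tensorDivergence (D.Sosc t) y - Torus.gradient (fun z => ∑ x, Torus.expansionPressure (D.cvec x t) (D.Psi x t) z) y +
        D.f₂ t y + D.f₃ t y + D.f₄ t) = 0 := by
    rw [hsums, ← e4]
    simp only [f₃, f₄]
    abel
  -- assemble
  rw [e1, e1X, e2, e3, e5, e6]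
  simp only [ffunW, f₁]
  rw [← sub_eq_zero]
  calc _ = (s t) ^ 2 • (∑ x, dirD x (D.F x t) y • dirVec x - ∑ x, (D.mup⁻¹ * (D.Fdot x t y - ∫ z, D.Fdot x t z)) • dirVec x -
      ∑ x, dirD x (JAmp.hsq D.γ₀ D.M x t) y • dirVec x -
      (Torus.tensorDivergence (D.Sosc t) y - Torus.gradient (fun z => ∑ x, Torus.expansionPressure (D.cvec x t) (D.Psi x t) z) y +
        D.f₂ t y + D.f₃ t y + D.f₄ t)) := by
        module
    _ = 0 := by rw [key, smul_zero]

/-! ## The new triple -/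

omit h in
/-- Symmetry of the weighted cross tensor. [folklore] -/
theorem crossW_symm (t : ℝ) (y : 𝕋³) (i j : Fin 3) : D.crossW s t y i j = D.crossW s t y j i := by
  have hc := tensorProd_symm_entries (fun z => s t • D.wp t z) (D.wrW s t) y i j
  simp only [crossW, PiLp.add_apply]
  rw [hc.2]
  linarith [hc.1]

/-- `S̃₁` is symmetric when `R_c` is. [folklore] -/
theorem S₁W_symm {Rc : ℝ → 𝕋³ → Fin 3 → E³} (hRcsym : ∀ t ∈ Icc 0 D.T, ∀ y, ∀ i j : Fin 3, Rc t y i j = Rc t y j i)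
    {t : ℝ} (ht : t ∈ Icc 0 D.T) (y : 𝕋³) (i j : Fin 3) : D.S₁W s Rc t y i j = D.S₁W s Rc t y j i := by
  have hosc : ∀ x, Torus.expansionTensor (D.cvec x t) (D.Psi x t) y i j = Torus.expansionTensor (D.cvec x t) (D.Psi x t) y j i :=
    fun x => (Torus.expansionTensor_symm (isSmooth_Psi h x ht) y i j).symm
  have hS : D.Sosc t y i j = D.Sosc t y j i := by
    simp only [Sosc]
    rw [show (∑ x, Torus.expansionTensor (D.cvec x t) (D.Psi x t) y i) j = ∑ x, Torus.expansionTensor (D.cvec x t) (D.Psi x t) y i j from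
        by simp [Finset.sum_apply],
      show (∑ x, Torus.expansionTensor (D.cvec x t) (D.Psi x t) y j) i = ∑ x, Torus.expansionTensor (D.cvec x t) (D.Psi x t) y j i from
        by simp [Finset.sum_apply], Finset.sum_congr rfl fun x _ => hosc x]
  simp only [S₁W, PiLp.add_apply, PiLp.smul_apply, smul_eq_mul]
  rw [hRcsym t ht y i j, crossW_symm (s := s) t y i j, hS]

include hs in
/-- **The new Navier–Stokes–Reynolds triple of the weighted step.** If `(v, P, R_c + s² N̊)` solves
the NSR system with viscosity `ν` on `[0, T] × 𝕋³` (with `R_c` jointly smooth and symmetric and `s`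
smooth on `[0, T]`), then so does `(v + w̃, p_new, R_new)` with
`R_new = S̃̊₁ + (v ⊗ w̃ + w̃ ⊗ v)˚ - ν(∇w̃' + ∇w̃'ᵀ)˚ + ℛ f̃` (`Torus.IsNSReynoldsOn.perturb_visc` with `(⋆_s)`).
[cite: BuckmasterVicol2019Annals, §7; BuckmasterVicol2020, §7.6.1 (7.47)–(7.51)] -/
theorem isNSReynoldsOn_newW {ν : ℝ} {v : ℝ → 𝕋³ → E³} {P : ℝ → 𝕋³ → ℝ} {Rc : ℝ → 𝕋³ → Fin 3 → E³}
    (hold : Torus.IsNSReynoldsOn (Icc 0 D.T) ν v P (fun t y j => Rc t y j + (s t) ^ 2 • Torus.traceless (D.M t) y j))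
    (hRc : Torus.IsSmoothSpaceTimeOn (Icc 0 D.T) Rc) (hRcsym : ∀ t ∈ Icc 0 D.T, ∀ y, ∀ i j : Fin 3, Rc t y i j = Rc t y j i) :
    Torus.IsNSReynoldsOn (Icc 0 D.T) ν (fun t y => v t y + D.wW s t y)
      (Torus.perturbedPressureV ν v (D.wW' s) (D.zetaW s) P (D.qfunW s) (D.S₁W s Rc))
      (Torus.perturbedStressV ν v (D.wW' s) (D.zetaW s) (D.S₁W s Rc) (D.ffunW s)) := by
  exact Torus.IsNSReynoldsOn.perturb_visc hd3 h.hT hold (smooth_wW' h hs) (smooth_zetaW h hs) (fun t ht => isDivFree_wW h hs ht)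
    (fun t ht => hasZeroMean_wW h hs ht) (smooth_S₁W h hs hRc) (fun t ht y i j => S₁W_symm h hRcsym ht y i j) (smooth_qfunW h hs)
    (smooth_ffunW h hs) (fun t ht y => starW h hs hRc ht y)

/-! ## Locality: where the weight and its derivative vanish nothing happens -/

omit h in
/-- At a time where `s = 0`: `w̃ = 0`, `w̃' = 0`, `ζ̃ = 0`, `w̃r = 0`. [folklore] -/
theorem wW_of_weight_eq_zero {t : ℝ} (h0 : s t = 0) :
    D.wW s t = 0 ∧ D.wW' s t = 0 ∧ D.zetaW s t = 0 ∧ D.wrW s t = 0 := by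
  have h1 : D.wW' s t = 0 := by funext y; simp [wW', h0]
  have h2 : D.zetaW s t = 0 := by funext y; simp [zetaW, h0]
  have h3 : D.wW s t = 0 := by
    funext y
    simp only [wW, h1, h2, Pi.zero_apply, zero_add]
    exact Torus.gradient_const (d := Fin 3) 0 y
  refine ⟨h3, h1, h2, ?_⟩
  funext y; simp [wrW, h3, h0]

omit h in
/-- At a time where `s = s' = 0` the source `f̃` vanishes. [folklore] -/
theorem ffunW_of_weight_eq_zero {t : ℝ} (h0 : s t = 0) (h0' : D.sdot s t = 0) : D.ffunW s t = 0 := by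
  funext y; simp [ffunW, h0, h0']

omit h in
/-- At a time where `s = 0` the weighted cross tensor vanishes and `S̃₁ = R_c`. [folklore] -/
theorem S₁W_of_weight_eq_zero (Rc : ℝ → 𝕋³ → Fin 3 → E³) {t : ℝ} (h0 : s t = 0) : D.S₁W s Rc t = Rc t := by
  have hr := (wW_of_weight_eq_zero (D := D) (s := s) h0).2.2.2
  funext y j
  simp [S₁W, crossW, Torus.tensorProd, hr, h0]

omit h in
/-- **Locality of the weighted step**: at a time where `s = s' = 0` the new velocity is `v` and the new
stress is `R̊_c`. [cite: BuckmasterVicol2019Annals, §7] -/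
theorem newW_of_weight_eq_zero (ν : ℝ) (v : ℝ → 𝕋³ → E³) (Rc : ℝ → 𝕋³ → Fin 3 → E³) {t : ℝ} (h0 : s t = 0) (h0' : D.sdot s t = 0) :
    (fun y => v t y + D.wW s t y) = v t ∧
    Torus.perturbedStressV ν v (D.wW' s) (D.zetaW s) (D.S₁W s Rc) (D.ffunW s) t = Torus.traceless (Rc t) := by
  obtain ⟨hw, hw', hζ, -⟩ := wW_of_weight_eq_zero (D := D) (s := s) h0
  refine ⟨by funext y; simp [hw], ?_⟩
  have hincr : Torus.incr (D.wW' s) (D.zetaW s) t = 0 := by rw [← wW_eq_incr]; exact hw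
  have hlin : Torus.linStress (v t) (Torus.incr (D.wW' s) (D.zetaW s) t) = fun _ _ => 0 := by
    funext y j; simp [Torus.linStress, Torus.tensorProd, hincr]
  have hsym : Torus.symGrad (D.wW' s t) = fun _ _ => 0 := by
    funext y j
    simp only [Torus.symGrad, hw']
    have e1 : Torus.partialDeriv j (0 : 𝕋³ → E³) y = 0 := Torus.partialDeriv_const_apply (0 : E³) j y
    have e2 : Torus.gradient (fun z : 𝕋³ => (0 : 𝕋³ → E³) z j) y = 0 := by
      have : (fun z : 𝕋³ => (0 : 𝕋³ → E³) z j) = fun _ => (0 : ℝ) := by funext z; rfl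
      rw [this]; exact Torus.gradient_const (d := Fin 3) 0 y
    rw [e1, e2, add_zero]
  have htr0 : Torus.traceless (fun (_ : 𝕋³) (_ : Fin 3) => (0 : E³)) = fun _ _ => 0 := by
    funext y j; simp [Torus.traceless_apply, Torus.tensorTrace]
  funext y j
  rw [Torus.perturbedStressV, S₁W_of_weight_eq_zero (D := D) Rc h0, hlin, hsym, htr0, ffunW_of_weight_eq_zero (D := D) h0 h0',
    Torus.antidivergence_zero]
  simp

end Datum

end JetStep

end Literature.Analysis.FluidPDE
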